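import Summits.QuantumFields.YangMills.Theses.ThermalDescent

/-!
# `ThermalDescent.OddTorusRP` (stmt-QuantumFields-27343): the support stub

Proves the registered stub `stub_support` of the birth skeleton
`Summits/QuantumFields/YangMills/Cruxes/NT/Lines/thermal_descent_oddrp_birth.lean`: under the item's side conditions
(`tsupport v ⊆ {δ₁ < x⁰ < δ₂}`, `0 < δ₁`, `δ₂ + s ≤ sL`, `0 < s`, `1 ≤ L`) the smeared field `B_v + D_v` on the odd torus
`(2L+1)⁴` depends only on the spatial links at times `≤ L` and the temporal links at times `≤ L − 1`: the Schwartz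
weight `v(s·x)` (resp. its forward time difference) vanishes unless the centred time coordinate of the base site lies in
`[1, L−2]` (resp. `[0, L−2]`), and a plaquette based at time `t` only involves links at times `t, t+1`, the temporal
ones at time `t`.  Pure bookkeeping; no summit, leg or spine crux is proved here. [folklore]
-/

set_option autoImplicit false
set_option maxHeartbeats 800000

namespace Summit.QuantumFields.YangMills.Theorems.ThermalDescentOddTorusRP

open Literature.MathematicalPhysics.QuantumFieldTheory

/-- Integer bounds from the support window: `δ₁ < s·n < δ₂`, `0 < δ₁`, `0 < s`, `δ₂ + s ≤ sL` force `1 ≤ n ≤ L − 2`.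
[folklore] -/
theorem int_window {L : ℕ} {s δ₁ δ₂ : ℝ} (hs : 0 < s) (hδ₁ : 0 < δ₁) (hδ₂ : δ₂ + s ≤ s * L) (n : ℤ)
    (h1 : δ₁ < s * (n : ℝ)) (h2 : s * (n : ℝ) < δ₂) : 1 ≤ n ∧ n + 2 ≤ (L : ℤ) := by
  have hn0 : (0 : ℝ) < n := by
    by_contra h; push Not at h; nlinarith
  have hnL : (n : ℝ) < (L : ℝ) - 1 := by
    by_contra h; push Not at h; nlinarith
  constructor
  · exact_mod_cast (show (0 : ℝ) < n from hn0)
  · have : (n : ℝ) + 1 < (L : ℤ) := by push_cast; linarith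
    have h' : n + 1 < (L : ℤ) := by exact_mod_cast this
    omega

variable {G : Type} [Group G]

/-- The time coordinate of a shifted site is at most one more. [folklore] -/
theorem shift_time_le {a n : ℕ} (x : FinTorusSite a a a (n + 1)) (μ : Fin 4) :
    (x.shift μ).2.2.2.val ≤ x.2.2.2.val + 1 := by
  obtain ⟨a, b, c, t⟩ := x
  fin_cases μ
  · show t.val ≤ t.val + 1; omega
  · show t.val ≤ t.val + 1; omega
  · show t.val ≤ t.val + 1; omega
  · show (finRotate (n + 1) t).val ≤ t.val + 1
    rw [coe_finRotate]; split_ifs <;> omega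

/-- Two configurations agreeing on all links at times `≤ m` have the same plaquettes based at times `≤ m − 1`.
[folklore] -/
theorem plaquette_congr {a n m : ℕ} {U V : FinTorusSite a a a (n + 1) × Fin 4 → G}
    (hUV : ∀ e : FinTorusSite a a a (n + 1) × Fin 4, e.1.2.2.2.val ≤ m → U e = V e)
    (x : FinTorusSite a a a (n + 1)) (hx : x.2.2.2.val + 1 ≤ m) (μ ν : Fin 4) :
    finTorusPlaquette U x μ ν = finTorusPlaquette V x μ ν := by
  unfold finTorusPlaquette
  rw [hUV (x, μ) (by simp; omega), hUV (x, ν) (by simp; omega),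
    hUV (x.shift μ, ν) (by have := shift_time_le x μ; simp; omega),
    hUV (x.shift ν, μ) (by have := shift_time_le x ν; simp; omega)]

/-- **The support stub of the `OddTorusRP` skeleton** (`Cruxes/NT/Lines/thermal_descent_oddrp_birth.lean`,
`stub_support`, VERBATIM). [folklore] -/
theorem stub_support : ∀ (G : Type) [Group G] [TopologicalSpace G] (r : LatticeRep G) (L : ℕ) (s : ℝ)
    (v : SchwartzMap (EuclideanSpace ℝ (Fin 4)) ℝ) (δ₁ δ₂ : ℝ), 1 ≤ L → 0 < s → 0 < δ₁ →
    tsupport v ⊆ {y : EuclideanSpace ℝ (Fin 4) | δ₁ < y 0 ∧ y 0 < δ₂} → δ₂ + s ≤ s * L →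
    DependsOn (fun U : FinTorusSite (2 * L + 1) (2 * L + 1) (2 * L + 1) (2 * L + 1) × Fin 4 → G =>
      (∑ x : FinTorusSite (2 * L + 1) (2 * L + 1) (2 * L + 1) (2 * L + 1),
        v (s • Literature.MathematicalPhysics.QuantumLattice.siteToE
          ![(if 2 * x.2.2.2.val < 2 * L + 1 then (x.2.2.2.val : ℤ) else (x.2.2.2.val : ℤ) - (2 * L + 1 : ℕ)),
            (if 2 * x.1.val < 2 * L + 1 then (x.1.val : ℤ) else (x.1.val : ℤ) - (2 * L + 1 : ℕ)),
            (if 2 * x.2.1.val < 2 * L + 1 then (x.2.1.val : ℤ) else (x.2.1.val : ℤ) - (2 * L + 1 : ℕ)),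
            (if 2 * x.2.2.1.val < 2 * L + 1 then (x.2.2.1.val : ℤ) else (x.2.2.1.val : ℤ) - (2 * L + 1 : ℕ))]) *
        ∑ q : {q : Fin 4 × Fin 4 // q.1 < q.2}, (r.ρ (finTorusPlaquette U x q.1.1 q.1.2)).trace.re) +
      ∑ x : FinTorusSite (2 * L + 1) (2 * L + 1) (2 * L + 1) (2 * L + 1),
        (v (s • Literature.MathematicalPhysics.QuantumLattice.siteToE
          ![(if 2 * x.2.2.2.val < 2 * L + 1 then (x.2.2.2.val : ℤ) else (x.2.2.2.val : ℤ) - (2 * L + 1 : ℕ)),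
            (if 2 * x.1.val < 2 * L + 1 then (x.1.val : ℤ) else (x.1.val : ℤ) - (2 * L + 1 : ℕ)),
            (if 2 * x.2.1.val < 2 * L + 1 then (x.2.1.val : ℤ) else (x.2.1.val : ℤ) - (2 * L + 1 : ℕ)),
            (if 2 * x.2.2.1.val < 2 * L + 1 then (x.2.2.1.val : ℤ) else (x.2.2.1.val : ℤ) - (2 * L + 1 : ℕ))] +
            s • EuclideanSpace.single (0 : Fin 4) (1 : ℝ)) -
         v (s • Literature.MathematicalPhysics.QuantumLattice.siteToE
          ![(if 2 * x.2.2.2.val < 2 * L + 1 then (x.2.2.2.val : ℤ) else (x.2.2.2.val : ℤ) - (2 * L + 1 : ℕ)),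
            (if 2 * x.1.val < 2 * L + 1 then (x.1.val : ℤ) else (x.1.val : ℤ) - (2 * L + 1 : ℕ)),
            (if 2 * x.2.1.val < 2 * L + 1 then (x.2.1.val : ℤ) else (x.2.1.val : ℤ) - (2 * L + 1 : ℕ)),
            (if 2 * x.2.2.1.val < 2 * L + 1 then (x.2.2.1.val : ℤ) else (x.2.2.1.val : ℤ) - (2 * L + 1 : ℕ))])) *
        ∑ i : Fin 3, (r.ρ (finTorusPlaquette U x (Fin.castSucc i) (Fin.last 3))).trace.re)
    {e : FinTorusSite (2 * L + 1) (2 * L + 1) (2 * L + 1) (2 * L + 1) × Fin 4 |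
      (e.2 ≠ Fin.last 3 ∧ e.1.2.2.2.val ≤ L) ∨ (e.2 = Fin.last 3 ∧ e.1.2.2.2.val + 1 ≤ L)} := by
  intro G _ _ r L s v δ₁ δ₂ hL hs hδ₁ hv hδ₂ U V hUV
  dsimp only
  -- links at times `≤ L - 1` agree
  have hUV' : ∀ e : FinTorusSite (2 * L + 1) (2 * L + 1) (2 * L + 1) (2 * L + 1) × Fin 4,
      e.1.2.2.2.val ≤ L - 1 → U e = V e := by
    intro e he
    refine hUV e ?_
    by_cases h3 : e.2 = Fin.last 3
    · exact Or.inr ⟨h3, by omega⟩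
    · exact Or.inl ⟨h3, by omega⟩
  -- the support window
  have key : ∀ p : EuclideanSpace ℝ (Fin 4), v p ≠ 0 → δ₁ < p 0 ∧ p 0 < δ₂ := fun p hp =>
    hv (subset_tsupport _ (Function.mem_support.mpr hp))
  -- time localisation of a base site from the window, for the centred coordinate `cc`
  have hcc : ∀ (t : Fin (2 * L + 1)) (k : ℤ), 0 ≤ k → k ≤ 1 →
      δ₁ < s * (((if 2 * t.val < 2 * L + 1 then (t.val : ℤ) else (t.val : ℤ) - (2 * L + 1 : ℕ)) + k : ℤ) : ℝ) →
      s * (((if 2 * t.val < 2 * L + 1 then (t.val : ℤ) else (t.val : ℤ) - (2 * L + 1 : ℕ)) + k : ℤ) : ℝ) < δ₂ →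
      t.val + 1 ≤ L - 1 := by
    intro t k hk hk1 h1 h2
    have hb := int_window hs hδ₁ hδ₂ _ h1 h2
    have ht := t.isLt
    split_ifs at hb with h2t
    · omega
    · push_cast at hb; omega
  congr 1
  · refine Finset.sum_congr rfl fun x _ => ?_
    by_cases hne : v (s • Literature.MathematicalPhysics.QuantumLattice.siteToE
          ![(if 2 * x.2.2.2.val < 2 * L + 1 then (x.2.2.2.val : ℤ) else (x.2.2.2.val : ℤ) - (2 * L + 1 : ℕ)),
            (if 2 * x.1.val < 2 * L + 1 then (x.1.val : ℤ) else (x.1.val : ℤ) - (2 * L + 1 : ℕ)),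
            (if 2 * x.2.1.val < 2 * L + 1 then (x.2.1.val : ℤ) else (x.2.1.val : ℤ) - (2 * L + 1 : ℕ)),
            (if 2 * x.2.2.1.val < 2 * L + 1 then (x.2.2.1.val : ℤ) else (x.2.2.1.val : ℤ) - (2 * L + 1 : ℕ))]) = 0
    · rw [hne, zero_mul, zero_mul]
    · have hw := key _ hne
      have ht : x.2.2.2.val + 1 ≤ L - 1 := by
        refine hcc x.2.2.2 0 le_rfl zero_le_one ?_ ?_
        · have h := hw.1
          simp only [PiLp.smul_apply, Literature.MathematicalPhysics.QuantumLattice.siteToE_apply,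
            Matrix.cons_val_zero, smul_eq_mul, add_zero] at h ⊢
          exact h
        · have h := hw.2
          simp only [PiLp.smul_apply, Literature.MathematicalPhysics.QuantumLattice.siteToE_apply,
            Matrix.cons_val_zero, smul_eq_mul, add_zero] at h ⊢
          exact h
      congr 1
      exact Finset.sum_congr rfl fun q _ => by rw [plaquette_congr hUV' x ht]
  · refine Finset.sum_congr rfl fun x _ => ?_
    by_cases hne : v (s • Literature.MathematicalPhysics.QuantumLattice.siteToE
          ![(if 2 * x.2.2.2.val < 2 * L + 1 then (x.2.2.2.val : ℤ) else (x.2.2.2.val : ℤ) - (2 * L + 1 : ℕ)),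
            (if 2 * x.1.val < 2 * L + 1 then (x.1.val : ℤ) else (x.1.val : ℤ) - (2 * L + 1 : ℕ)),
            (if 2 * x.2.1.val < 2 * L + 1 then (x.2.1.val : ℤ) else (x.2.1.val : ℤ) - (2 * L + 1 : ℕ)),
            (if 2 * x.2.2.1.val < 2 * L + 1 then (x.2.2.1.val : ℤ) else (x.2.2.1.val : ℤ) - (2 * L + 1 : ℕ))] +
            s • EuclideanSpace.single (0 : Fin 4) (1 : ℝ)) -
         v (s • Literature.MathematicalPhysics.QuantumLattice.siteToE
          ![(if 2 * x.2.2.2.val < 2 * L + 1 then (x.2.2.2.val : ℤ) else (x.2.2.2.val : ℤ) - (2 * L + 1 : ℕ)),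
            (if 2 * x.1.val < 2 * L + 1 then (x.1.val : ℤ) else (x.1.val : ℤ) - (2 * L + 1 : ℕ)),
            (if 2 * x.2.1.val < 2 * L + 1 then (x.2.1.val : ℤ) else (x.2.1.val : ℤ) - (2 * L + 1 : ℕ)),
            (if 2 * x.2.2.1.val < 2 * L + 1 then (x.2.2.1.val : ℤ) else (x.2.2.1.val : ℤ) - (2 * L + 1 : ℕ))]) = 0
    · rw [hne, zero_mul, zero_mul]
    · -- one of the two values is nonzero
      have ht : x.2.2.2.val + 1 ≤ L - 1 := by
        by_cases hne0 : v (s • Literature.MathematicalPhysics.QuantumLattice.siteToE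
          ![(if 2 * x.2.2.2.val < 2 * L + 1 then (x.2.2.2.val : ℤ) else (x.2.2.2.val : ℤ) - (2 * L + 1 : ℕ)),
            (if 2 * x.1.val < 2 * L + 1 then (x.1.val : ℤ) else (x.1.val : ℤ) - (2 * L + 1 : ℕ)),
            (if 2 * x.2.1.val < 2 * L + 1 then (x.2.1.val : ℤ) else (x.2.1.val : ℤ) - (2 * L + 1 : ℕ)),
            (if 2 * x.2.2.1.val < 2 * L + 1 then (x.2.2.1.val : ℤ) else (x.2.2.1.val : ℤ) - (2 * L + 1 : ℕ))]) = 0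
        · rw [hne0, sub_zero] at hne
          have hw := key _ hne
          refine hcc x.2.2.2 1 zero_le_one le_rfl ?_ ?_
          · have h := hw.1
            simp only [PiLp.add_apply, PiLp.smul_apply, Literature.MathematicalPhysics.QuantumLattice.siteToE_apply,
              Matrix.cons_val_zero, smul_eq_mul, PiLp.single_apply, if_true, mul_one] at h
            push_cast at h ⊢
            linarith
          · have h := hw.2
            simp only [PiLp.add_apply, PiLp.smul_apply, Literature.MathematicalPhysics.QuantumLattice.siteToE_apply,
              Matrix.cons_val_zero, smul_eq_mul, PiLp.single_apply, if_true, mul_one] at h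
            push_cast at h ⊢
            linarith
        · have hw := key _ hne0
          refine hcc x.2.2.2 0 le_rfl zero_le_one ?_ ?_
          · have h := hw.1
            simp only [PiLp.smul_apply, Literature.MathematicalPhysics.QuantumLattice.siteToE_apply,
              Matrix.cons_val_zero, smul_eq_mul, add_zero] at h ⊢
            exact h
          · have h := hw.2
            simp only [PiLp.smul_apply, Literature.MathematicalPhysics.QuantumLattice.siteToE_apply,
              Matrix.cons_val_zero, smul_eq_mul, add_zero] at h ⊢
            exact h
      congr 1
      exact Finset.sum_congr rfl fun i _ => by rw [plaquette_congr hUV' x ht]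

end Summit.QuantumFields.YangMills.Theorems.ThermalDescentOddTorusRP
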